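import Literature.Probability.Percolation.FourArmGarbanProofs
import HarnessLib

/-!
# The boundary cycle of the square box `B(N)` of `ℤ²`: a counter-clockwise parametrisation

Topic `Literature/Probability/Percolation` (planar toolkit); DEFINITIONS with bodies and PROOFS
(no named fact).  Infrastructure for interlacing statements on the box `B(N) = {‖x‖_∞ ≤ N}`
("paths joining alternate boundary arcs must intersect", Kesten 1982, §2.2–2.3; Chelkak–
Duminil-Copin–Hongler 2016, §2.1 "natural cyclic order on `∂Ω`"): the counter-clockwise
parametrisation of the boundary `siteSphere N` by positions `t`, starting at the bottom-right
corner `(N, -N)` — right side upwards (`t < 2N`), top side leftwards, left side downwards, bottom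
side rightwards (`6N ≤ t < 8N`) — extended periodically to three laps `t < 24N` so that arcs
through the starting corner need no modular arithmetic.

* `bpt N t` — the boundary vertex at position `t`; `bpt_mem_siteSphere`, `bpt_adj`
  (consecutive positions are lattice-adjacent), `bpt_add` (period `8N`), `bpt_inj` (injective on a
  lap), `exists_bpt_eq` (every boundary vertex has a position `< 8N`);
* `bwalk hN t k` — the counter-clockwise boundary walk of `k` steps from position `t`
  (`t + k < 24N`), its support and edges (`mem_support_bwalk_iff`, `mem_edges_bwalk_iff`),
  `bwalk_add` (concatenation);
* `bedge N t` — the boundary edge between positions `t` and `t+1`; `bedge_eq_bedge_iff`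
  (equal iff equal positions modulo `8N`, `N ≥ 1`); `bface N t` / `oface N t` — the faces
  inside / outside the box across that edge, and their coordinates per side.

## References

* H. Kesten, *Percolation theory for mathematicians* (1982), §2.2–2.3 [KestenPTM1982].
* D. Chelkak, H. Duminil-Copin, C. Hongler, EJP 21 (2016), no. 5, §2.1 [ChelkakDuminilHongler2016].
-/

noncomputable section

open SimpleGraph Finset

namespace Literature.Probability.Percolation

open LatticeModels

variable {N : ℕ}

/-! ### Positions on one lap -/

/-- The boundary vertex of `B(N)` at counter-clockwise position `t < 8N` from the corner `(N,-N)`.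
[folklore] -/
def bptCore (N t : ℕ) : Site 2 :=
  if t < 2 * N then ![(N : ℤ), -(N : ℤ) + t]
  else if t < 4 * N then ![3 * (N : ℤ) - t, (N : ℤ)]
  else if t < 6 * N then ![-(N : ℤ), 5 * (N : ℤ) - t]
  else ![(t : ℤ) - 7 * N, -(N : ℤ)]

/-- The boundary vertex at position `t`, three laps (`t < 24N`). [folklore] -/
def bpt (N t : ℕ) : Site 2 :=
  if t < 8 * N then bptCore N t else if t < 16 * N then bptCore N (t - 8 * N) else bptCore N (t - 16 * N)

/-- The reduced position of `t < 24N` on the first lap. [folklore] -/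
def bred (N t : ℕ) : ℕ := if t < 8 * N then t else if t < 16 * N then t - 8 * N else t - 16 * N

/-- `bpt` through the reduced position. [folklore] -/
theorem bpt_eq_bptCore_bred (N t : ℕ) : bpt N t = bptCore N (bred N t) := by
  unfold bpt bred; split_ifs <;> rfl

/-- The reduced position is on the first lap. [folklore] -/
theorem bred_lt {t : ℕ} (ht : t < 24 * N) : bred N t < 8 * N := by
  unfold bred; split_ifs <;> omega

/-- Coordinates of `bptCore`. [folklore] -/
theorem bptCore_apply (N t : ℕ) :
    (bptCore N t 0 = if t < 2 * N then (N : ℤ) else if t < 4 * N then 3 * (N : ℤ) - t else if t < 6 * N then -(N : ℤ)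
        else (t : ℤ) - 7 * N) ∧
      (bptCore N t 1 = if t < 2 * N then -(N : ℤ) + t else if t < 4 * N then (N : ℤ) else if t < 6 * N then 5 * (N : ℤ) - t
        else -(N : ℤ)) := by
  unfold bptCore; split_ifs <;> simp

/-- `bptCore` is injective on a lap (`N ≥ 1`). [folklore] -/
theorem bptCore_inj (hN : 1 ≤ N) {t t' : ℕ} (ht : t < 8 * N) (ht' : t' < 8 * N) (h : bptCore N t = bptCore N t') : t = t' := by
  have h0 := congrFun h 0
  have h1 := congrFun h 1
  obtain ⟨a0, a1⟩ := bptCore_apply N t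
  obtain ⟨b0, b1⟩ := bptCore_apply N t'
  rw [a0, b0] at h0
  rw [a1, b1] at h1
  split_ifs at h0 h1 <;> omega

/-- `bptCore` lies on the sphere `‖·‖_∞ = N`. [folklore] -/
theorem bptCore_mem_siteSphere (hN : 1 ≤ N) {t : ℕ} (ht : t < 8 * N) : bptCore N t ∈ siteSphere N := by
  rw [mem_siteSphere_iff hN]
  obtain ⟨a0, a1⟩ := bptCore_apply N t
  refine ⟨fun i => ?_, ?_⟩
  · fin_cases i
    · show -(N : ℤ) ≤ bptCore N t 0 ∧ bptCore N t 0 ≤ N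
      rw [a0]; split_ifs <;> omega
    · show -(N : ℤ) ≤ bptCore N t 1 ∧ bptCore N t 1 ≤ N
      rw [a1]; split_ifs <;> omega
  · by_cases h2 : t < 2 * N
    · exact ⟨0, Or.inl (by rw [a0, if_pos h2])⟩
    by_cases h4 : t < 4 * N
    · exact ⟨1, Or.inl (by rw [a1, if_neg h2, if_pos h4])⟩
    by_cases h6 : t < 6 * N
    · exact ⟨0, Or.inr (by rw [a0, if_neg h2, if_neg h4, if_pos h6])⟩
    · exact ⟨1, Or.inr (by rw [a1, if_neg h2, if_neg h4, if_neg h6])⟩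

/-- Consecutive positions of a lap are adjacent. [folklore] -/
theorem bptCore_adj {t : ℕ} (ht : t + 1 < 8 * N) : (zdGraph 2).Adj (bptCore N t) (bptCore N (t + 1)) := by
  obtain ⟨a0, a1⟩ := bptCore_apply N t
  obtain ⟨b0, b1⟩ := bptCore_apply N (t + 1)
  push_cast at b0 b1
  by_cases h2 : t + 1 < 2 * N
  · refine adj_of_stepKind (.up ?_ ?_) <;> [rw [b1, a1]; rw [b0, a0]] <;> split_ifs <;> omega
  by_cases h2' : t < 2 * N
  · -- `t = 2N - 1`: from `(N, N-1)` up to `(N, N)`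
    refine adj_of_stepKind (.up ?_ ?_) <;> [rw [b1, a1]; rw [b0, a0]] <;> split_ifs <;> omega
  by_cases h4 : t + 1 < 4 * N
  · refine adj_of_stepKind (.left ?_ ?_) <;> [rw [a0, b0]; rw [b1, a1]] <;> split_ifs <;> omega
  by_cases h4' : t < 4 * N
  · refine adj_of_stepKind (.left ?_ ?_) <;> [rw [a0, b0]; rw [b1, a1]] <;> split_ifs <;> omega
  by_cases h6 : t + 1 < 6 * N
  · refine adj_of_stepKind (.down ?_ ?_) <;> [rw [a1, b1]; rw [b0, a0]] <;> split_ifs <;> omega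
  by_cases h6' : t < 6 * N
  · refine adj_of_stepKind (.down ?_ ?_) <;> [rw [a1, b1]; rw [b0, a0]] <;> split_ifs <;> omega
  · refine adj_of_stepKind (.right ?_ ?_) <;> [rw [b0, a0]; rw [b1, a1]] <;> split_ifs <;> omega

/-- The lap closes up: the last position is adjacent to the first. [folklore] -/
theorem bptCore_adj_wrap (hN : 1 ≤ N) : (zdGraph 2).Adj (bptCore N (8 * N - 1)) (bptCore N 0) := by
  obtain ⟨a0, a1⟩ := bptCore_apply N (8 * N - 1)
  obtain ⟨b0, b1⟩ := bptCore_apply N 0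
  have hc : ((8 * N - 1 : ℕ) : ℤ) = 8 * N - 1 := by push_cast [Nat.cast_sub (show 1 ≤ 8 * N by omega)]; ring
  rw [hc] at a0 a1
  refine adj_of_stepKind (.right ?_ ?_) <;> [rw [b0, a0]; rw [b1, a1]] <;> split_ifs <;> push_cast <;> omega

/-- Every boundary vertex has a position on the lap. [folklore] -/
theorem exists_bptCore_eq (hN : 1 ≤ N) {v : Site 2} (hv : v ∈ siteSphere N) : ∃ t < 8 * N, bptCore N t = v := by
  rw [mem_siteSphere_iff hN] at hv
  obtain ⟨hb, hi⟩ := hv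
  have hi' := Fin.exists_fin_two.1 hi
  have h0 := hb 0
  have h1 := hb 1
  -- classify by side (right: x = N, y < N; top: y = N, x > -N; left: x = -N, y > -N; bottom)
  by_cases hr : v 0 = N ∧ v 1 < N
  · refine ⟨(v 1 + N).toNat, by omega, ?_⟩
    obtain ⟨a0, a1⟩ := bptCore_apply N (v 1 + N).toNat
    rw [Site.eq_iff_two, a0, a1]
    split_ifs <;> omega
  by_cases ht : v 1 = N ∧ -(N : ℤ) < v 0
  · refine ⟨(3 * N - v 0).toNat, by omega, ?_⟩
    obtain ⟨a0, a1⟩ := bptCore_apply N (3 * N - v 0).toNat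
    rw [Site.eq_iff_two, a0, a1]
    split_ifs <;> omega
  by_cases hl : v 0 = -(N : ℤ) ∧ -(N : ℤ) < v 1
  · refine ⟨(5 * N - v 1).toNat, by omega, ?_⟩
    obtain ⟨a0, a1⟩ := bptCore_apply N (5 * N - v 1).toNat
    rw [Site.eq_iff_two, a0, a1]
    split_ifs <;> omega
  · have hbt : v 1 = -(N : ℤ) ∧ v 0 < N := by omega
    refine ⟨(7 * N + v 0).toNat, by omega, ?_⟩
    obtain ⟨a0, a1⟩ := bptCore_apply N (7 * N + v 0).toNat
    rw [Site.eq_iff_two, a0, a1]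
    split_ifs <;> omega

/-! ### Three laps -/

/-- Period `8N`. [folklore] -/
theorem bpt_add {t : ℕ} (ht : t < 16 * N) : bpt N (t + 8 * N) = bpt N t := by
  unfold bpt
  split_ifs <;> first | rfl | (congr 1; omega)

/-- The boundary vertex at any position lies on the sphere. [folklore] -/
theorem bpt_mem_siteSphere (hN : 1 ≤ N) {t : ℕ} (ht : t < 24 * N) : bpt N t ∈ siteSphere N := by
  rw [bpt_eq_bptCore_bred]; exact bptCore_mem_siteSphere hN (bred_lt ht)

/-- Consecutive positions are adjacent. [folklore] -/
theorem bpt_adj (hN : 1 ≤ N) {t : ℕ} (ht : t + 1 < 24 * N) : (zdGraph 2).Adj (bpt N t) (bpt N (t + 1)) := by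
  unfold bpt
  by_cases h1 : t + 1 < 8 * N
  · rw [if_pos (by omega), if_pos h1]; exact bptCore_adj h1
  by_cases h1' : t < 8 * N
  · rw [if_pos h1', if_neg h1, if_pos (by omega)]
    have : t = 8 * N - 1 := by omega
    subst this
    rw [show 8 * N - 1 + 1 - 8 * N = 0 by omega]
    exact bptCore_adj_wrap hN
  by_cases h2 : t + 1 < 16 * N
  · rw [if_neg h1', if_pos (by omega), if_neg h1, if_pos h2, show t + 1 - 8 * N = t - 8 * N + 1 by omega]
    exact bptCore_adj (by omega)
  by_cases h2' : t < 16 * N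
  · rw [if_neg h1', if_pos h2', if_neg h1, if_neg h2]
    have : t = 16 * N - 1 := by omega
    subst this
    rw [show 16 * N - 1 - 8 * N = 8 * N - 1 by omega, show 16 * N - 1 + 1 - 16 * N = 0 by omega]
    exact bptCore_adj_wrap hN
  · rw [if_neg h1', if_neg h2', if_neg h1, if_neg h2, show t + 1 - 16 * N = t - 16 * N + 1 by omega]
    exact bptCore_adj (by omega)

/-- **Equal boundary vertices have equal reduced positions.** [folklore] -/
theorem bred_eq_of_bpt_eq (hN : 1 ≤ N) {t t' : ℕ} (ht : t < 24 * N) (ht' : t' < 24 * N) (h : bpt N t = bpt N t') :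
    bred N t = bred N t' := by
  rw [bpt_eq_bptCore_bred, bpt_eq_bptCore_bred] at h
  exact bptCore_inj hN (bred_lt ht) (bred_lt ht') h

/-- Reduced positions, unfolded for `omega`. [folklore] -/
theorem bred_eq (N t : ℕ) : (t < 8 * N ∧ bred N t = t) ∨ (8 * N ≤ t ∧ t < 16 * N ∧ bred N t = t - 8 * N) ∨
    (16 * N ≤ t ∧ bred N t = t - 16 * N) := by
  unfold bred; split_ifs <;> omega

/-- `bpt` is injective on a lap. [folklore] -/
theorem bpt_inj (hN : 1 ≤ N) {t t' : ℕ} (ht : t < 8 * N) (ht' : t' < 8 * N) (h : bpt N t = bpt N t') : t = t' := by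
  have := bred_eq_of_bpt_eq hN (by omega) (by omega) h
  rcases bred_eq N t with h1 | h1 | h1 <;> rcases bred_eq N t' with h2 | h2 | h2 <;> omega

/-- Every boundary vertex has a position `< 8N`. [folklore] -/
theorem exists_bpt_eq (hN : 1 ≤ N) {v : Site 2} (hv : v ∈ siteSphere N) : ∃ t < 8 * N, bpt N t = v := by
  obtain ⟨t, ht, htv⟩ := exists_bptCore_eq hN hv
  exact ⟨t, ht, by rw [bpt, if_pos ht, htv]⟩

/-! ### The counter-clockwise boundary walk -/

/-- The counter-clockwise boundary walk of `k` steps from position `t` (`t + k < 24N`). [folklore] -/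
def bwalk (hN : 1 ≤ N) : (t k : ℕ) → t + k < 24 * N → (zdGraph 2).Walk (bpt N t) (bpt N (t + k))
  | t, 0, _ => Walk.nil
  | t, k + 1, h => Walk.cons (bpt_adj hN (t := t) (by omega)) ((bwalk hN (t + 1) k (by omega)).copy rfl (by rw [Nat.add_right_comm, Nat.add_assoc]))

/-- Vertices of the boundary walk. [folklore] -/
theorem mem_support_bwalk_iff (hN : 1 ≤ N) {t k : ℕ} (h : t + k < 24 * N) {z : Site 2} :
    z ∈ (bwalk hN t k h).support ↔ ∃ i ≤ k, z = bpt N (t + i) := by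
  induction k generalizing t with
  | zero => simp [bwalk]
  | succ k ih =>
    rw [bwalk, Walk.support_cons, List.mem_cons, Walk.support_copy, ih]
    constructor
    · rintro (rfl | ⟨i, hi, rfl⟩)
      · exact ⟨0, by omega, by simp⟩
      · exact ⟨i + 1, by omega, by rw [Nat.add_assoc, Nat.add_comm 1 i]⟩
    · rintro ⟨i, hi, rfl⟩
      rcases Nat.eq_zero_or_pos i with rfl | hi0
      · exact Or.inl (by simp)
      · exact Or.inr ⟨i - 1, by omega, by congr 1; omega⟩

/-- Edges of the boundary walk. [folklore] -/
theorem mem_edges_bwalk_iff (hN : 1 ≤ N) {t k : ℕ} (h : t + k < 24 * N) {e : Sym2 (Site 2)} :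
    e ∈ (bwalk hN t k h).edges ↔ ∃ i < k, e = s(bpt N (t + i), bpt N (t + i + 1)) := by
  induction k generalizing t with
  | zero => simp [bwalk]
  | succ k ih =>
    rw [bwalk, Walk.edges_cons, List.mem_cons, Walk.edges_copy, ih]
    constructor
    · rintro (rfl | ⟨i, hi, rfl⟩)
      · exact ⟨0, by omega, by simp⟩
      · exact ⟨i + 1, by omega, by rw [show t + 1 + i = t + (i + 1) by omega]⟩
    · rintro ⟨i, hi, rfl⟩
      rcases Nat.eq_zero_or_pos i with rfl | hi0
      · exact Or.inl (by simp)
      · exact Or.inr ⟨i - 1, by omega, by rw [show t + 1 + (i - 1) = t + i by omega]⟩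

/-- Darts of the boundary walk go forward. [folklore] -/
theorem darts_bwalk (hN : 1 ≤ N) {t k : ℕ} (h : t + k < 24 * N) :
    ∀ d ∈ (bwalk hN t k h).darts, ∃ i < k, d.fst = bpt N (t + i) ∧ d.snd = bpt N (t + i + 1) := by
  induction k generalizing t with
  | zero => simp [bwalk]
  | succ k ih =>
    intro d hd
    rw [bwalk, Walk.darts_cons, List.mem_cons, Walk.darts_copy] at hd
    rcases hd with rfl | hd
    · exact ⟨0, by omega, rfl, rfl⟩
    · obtain ⟨i, hi, h1, h2⟩ := ih (by omega) d hd
      exact ⟨i + 1, by omega, by rw [h1]; congr 1; omega, by rw [h2]; congr 1; omega⟩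

/-- The vertices of the boundary walk lie in the box. [folklore] -/
theorem support_bwalk_mem_box (hN : 1 ≤ N) {t k : ℕ} (h : t + k < 24 * N) :
    ∀ z ∈ (bwalk hN t k h).support, -(N : ℤ) ≤ z 0 ∧ z 0 ≤ N ∧ -(N : ℤ) ≤ z 1 ∧ z 1 ≤ N := by
  intro z hz
  obtain ⟨i, hi, rfl⟩ := (mem_support_bwalk_iff hN h).1 hz
  have := (mem_siteSphere_iff hN).1 (bpt_mem_siteSphere hN (t := t + i) (by omega))
  exact ⟨(this.1 0).1, (this.1 0).2, (this.1 1).1, (this.1 1).2⟩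

/-! ### Boundary edges and the faces across them -/

/-- The boundary edge between positions `t` and `t+1`. [folklore] -/
def bedge (N t : ℕ) : Sym2 (Site 2) := s(bpt N t, bpt N (t + 1))

/-- **Boundary edges at different positions of a lap are different** (`N ≥ 1`): for `t, t' < 24N`
with `t' + 1 ≤ … `, `bedge N t = bedge N t'` forces equal reduced positions. [folklore] -/
theorem bred_eq_of_bedge_eq (hN : 1 ≤ N) {t t' : ℕ} (ht : t + 1 < 24 * N) (ht' : t' + 1 < 24 * N)
    (h : bedge N t = bedge N t') : bred N t = bred N t' := by
  rw [bedge, bedge, Sym2.eq_iff] at h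
  rcases h with ⟨h1, -⟩ | ⟨h1, h2⟩
  · exact bred_eq_of_bpt_eq hN (by omega) (by omega) h1
  · -- `t ≡ t' + 1` and `t + 1 ≡ t'` modulo `8N ≥ 8`: impossible
    exfalso
    have e1 := bred_eq_of_bpt_eq hN (by omega) (by omega) h1
    have e2 := bred_eq_of_bpt_eq hN (by omega) (by omega) h2
    rcases bred_eq N t with a | a | a <;> rcases bred_eq N (t' + 1) with b | b | b <;>
      rcases bred_eq N (t + 1) with c | c | c <;> rcases bred_eq N t' with d | d | d <;> omega

/-- The face INSIDE the box across the boundary edge at position `t` (lower-left corner). [folklore] -/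
def bface (N t : ℕ) : Site 2 :=
  if bred N t < 2 * N then ![(N : ℤ) - 1, -(N : ℤ) + bred N t]
  else if bred N t < 4 * N then ![3 * (N : ℤ) - bred N t - 1, (N : ℤ) - 1]
  else if bred N t < 6 * N then ![-(N : ℤ), 5 * (N : ℤ) - bred N t - 1]
  else ![(bred N t : ℤ) - 7 * N, -(N : ℤ)]

/-- The face OUTSIDE the box across the boundary edge at position `t`. [folklore] -/
def oface (N t : ℕ) : Site 2 :=
  if bred N t < 2 * N then ![(N : ℤ), -(N : ℤ) + bred N t]
  else if bred N t < 4 * N then ![3 * (N : ℤ) - bred N t - 1, (N : ℤ)]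
  else if bred N t < 6 * N then ![-(N : ℤ) - 1, 5 * (N : ℤ) - bred N t - 1]
  else ![(bred N t : ℤ) - 7 * N, -(N : ℤ) - 1]

/-- The side of a position: `0` right, `1` top, `2` left, `3` bottom, read off the reduced position. [folklore] -/
theorem bred_cases {t : ℕ} (ht : t < 24 * N) :
    bred N t < 2 * N ∨ (2 * N ≤ bred N t ∧ bred N t < 4 * N) ∨ (4 * N ≤ bred N t ∧ bred N t < 6 * N) ∨
      (6 * N ≤ bred N t ∧ bred N t < 8 * N) := by
  have := bred_lt ht; omega

/-- Coordinates of the two endpoints of the boundary edge at position `t` with `bred (t+1) = bred t + 1`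
(no wrap inside the edge). [folklore] -/
theorem bred_succ {t : ℕ} (ht : t + 1 < 24 * N) :
    bred N (t + 1) = bred N t + 1 ∨ (bred N t = 8 * N - 1 ∧ bred N (t + 1) = 0) := by
  rcases bred_eq N t with a | a | a <;> rcases bred_eq N (t + 1) with b | b | b <;> omega

/-- Coordinates of `bpt` through the reduced position. [folklore] -/
theorem bpt_apply (N t : ℕ) :
    (bpt N t 0 = if bred N t < 2 * N then (N : ℤ) else if bred N t < 4 * N then 3 * (N : ℤ) - bred N t
        else if bred N t < 6 * N then -(N : ℤ) else (bred N t : ℤ) - 7 * N) ∧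
      (bpt N t 1 = if bred N t < 2 * N then -(N : ℤ) + bred N t else if bred N t < 4 * N then (N : ℤ)
        else if bred N t < 6 * N then 5 * (N : ℤ) - bred N t else -(N : ℤ)) := by
  rw [bpt_eq_bptCore_bred]; exact bptCore_apply N (bred N t)

/-- Coordinates of `bface`. [folklore] -/
theorem bface_apply (N t : ℕ) :
    (bface N t 0 = if bred N t < 2 * N then (N : ℤ) - 1 else if bred N t < 4 * N then 3 * (N : ℤ) - bred N t - 1
        else if bred N t < 6 * N then -(N : ℤ) else (bred N t : ℤ) - 7 * N) ∧
      (bface N t 1 = if bred N t < 2 * N then -(N : ℤ) + bred N t else if bred N t < 4 * N then (N : ℤ) - 1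
        else if bred N t < 6 * N then 5 * (N : ℤ) - bred N t - 1 else -(N : ℤ)) := by
  unfold bface; split_ifs <;> simp

/-- Coordinates of `oface`. [folklore] -/
theorem oface_apply (N t : ℕ) :
    (oface N t 0 = if bred N t < 2 * N then (N : ℤ) else if bred N t < 4 * N then 3 * (N : ℤ) - bred N t - 1
        else if bred N t < 6 * N then -(N : ℤ) - 1 else (bred N t : ℤ) - 7 * N) ∧
      (oface N t 1 = if bred N t < 2 * N then -(N : ℤ) + bred N t else if bred N t < 4 * N then (N : ℤ)
        else if bred N t < 6 * N then 5 * (N : ℤ) - bred N t - 1 else -(N : ℤ) - 1) := by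
  unfold oface; split_ifs <;> simp

/-- **The inside face lies inside the box.** [folklore] -/
theorem bface_bounds (hN : 1 ≤ N) {t : ℕ} (ht : t < 24 * N) :
    -(N : ℤ) ≤ bface N t 0 ∧ bface N t 0 + 1 ≤ N ∧ -(N : ℤ) ≤ bface N t 1 ∧ bface N t 1 + 1 ≤ N := by
  obtain ⟨a0, a1⟩ := bface_apply N t
  have := bred_lt ht
  rw [a0, a1]; split_ifs <;> omega

/-- **Right side** (`bred t < 2N`): the edge goes up from `u + e₀` to `u + e₀ + e₁`, `u = bface`, and the
outside face is `u + e₀`. [folklore] -/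
theorem bedge_right (hN : 1 ≤ N) {t : ℕ} (ht : t + 1 < 24 * N) (hs : bred N t < 2 * N) :
    bpt N t = bface N t + Pi.single 0 1 ∧ bpt N (t + 1) = bface N t + Pi.single 0 1 + Pi.single 1 1 ∧
      oface N t = bface N t + Pi.single 0 1 := by
  obtain ⟨a0, a1⟩ := bpt_apply N t
  obtain ⟨b0, b1⟩ := bpt_apply N (t + 1)
  obtain ⟨f0, f1⟩ := bface_apply N t
  obtain ⟨o0, o1⟩ := oface_apply N t
  have hsucc := bred_succ ht
  have hlt := bred_lt (t := t + 1) ht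
  refine ⟨?_, ?_, ?_⟩ <;> rw [Site.eq_iff_two] <;>
    simp only [Pi.add_apply, single_zero_apply_zero, single_zero_apply_one, single_one_apply_zero,
      single_one_apply_one] <;> [rw [a0, a1, f0, f1]; rw [b0, b1, f0, f1]; rw [o0, o1, f0, f1]] <;>
    split_ifs <;> omega

/-- **Top side** (`2N ≤ bred t < 4N`): the edge goes left from `u + e₁ + e₀` to `u + e₁`, `u = bface`, and
the outside face is `u + e₁`. [folklore] -/
theorem bedge_top (hN : 1 ≤ N) {t : ℕ} (ht : t + 1 < 24 * N) (hs : 2 * N ≤ bred N t) (hs' : bred N t < 4 * N) :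
    bpt N t = bface N t + Pi.single 1 1 + Pi.single 0 1 ∧ bpt N (t + 1) = bface N t + Pi.single 1 1 ∧
      oface N t = bface N t + Pi.single 1 1 := by
  obtain ⟨a0, a1⟩ := bpt_apply N t
  obtain ⟨b0, b1⟩ := bpt_apply N (t + 1)
  obtain ⟨f0, f1⟩ := bface_apply N t
  obtain ⟨o0, o1⟩ := oface_apply N t
  have hsucc := bred_succ ht
  have hlt := bred_lt (t := t + 1) ht
  refine ⟨?_, ?_, ?_⟩ <;> rw [Site.eq_iff_two] <;>
    simp only [Pi.add_apply, single_zero_apply_zero, single_zero_apply_one, single_one_apply_zero,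
      single_one_apply_one] <;> [rw [a0, a1, f0, f1]; rw [b0, b1, f0, f1]; rw [o0, o1, f0, f1]] <;>
    split_ifs <;> omega

/-- **Left side** (`4N ≤ bred t < 6N`): the edge goes down from `u + e₀ + e₁` to `u + e₀`, `u = oface`, and
the inside face is `u + e₀`. [folklore] -/
theorem bedge_left (hN : 1 ≤ N) {t : ℕ} (ht : t + 1 < 24 * N) (hs : 4 * N ≤ bred N t) (hs' : bred N t < 6 * N) :
    bpt N t = oface N t + Pi.single 0 1 + Pi.single 1 1 ∧ bpt N (t + 1) = oface N t + Pi.single 0 1 ∧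
      bface N t = oface N t + Pi.single 0 1 := by
  obtain ⟨a0, a1⟩ := bpt_apply N t
  obtain ⟨b0, b1⟩ := bpt_apply N (t + 1)
  obtain ⟨f0, f1⟩ := bface_apply N t
  obtain ⟨o0, o1⟩ := oface_apply N t
  have hsucc := bred_succ ht
  have hlt := bred_lt (t := t + 1) ht
  refine ⟨?_, ?_, ?_⟩ <;> rw [Site.eq_iff_two] <;>
    simp only [Pi.add_apply, single_zero_apply_zero, single_zero_apply_one, single_one_apply_zero,
      single_one_apply_one] <;> [rw [a0, a1, o0, o1]; rw [b0, b1, o0, o1]; rw [f0, f1, o0, o1]] <;>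
    split_ifs <;> omega

/-- **Bottom side** (`6N ≤ bred t`): the edge goes right from `u + e₁` to `u + e₁ + e₀`, `u = oface`, and
the inside face is `u + e₁`. [folklore] -/
theorem bedge_bottom (hN : 1 ≤ N) {t : ℕ} (ht : t + 1 < 24 * N) (hs : 6 * N ≤ bred N t) :
    bpt N t = oface N t + Pi.single 1 1 ∧ bpt N (t + 1) = oface N t + Pi.single 1 1 + Pi.single 0 1 ∧
      bface N t = oface N t + Pi.single 1 1 := by
  obtain ⟨a0, a1⟩ := bpt_apply N t
  obtain ⟨b0, b1⟩ := bpt_apply N (t + 1)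
  obtain ⟨f0, f1⟩ := bface_apply N t
  obtain ⟨o0, o1⟩ := oface_apply N t
  have hsucc := bred_succ ht
  have hlt := bred_lt (t := t + 1) ht
  have hlt' := bred_lt (N := N) (t := t) (by omega)
  refine ⟨?_, ?_, ?_⟩ <;> rw [Site.eq_iff_two] <;>
    simp only [Pi.add_apply, single_zero_apply_zero, single_zero_apply_one, single_one_apply_zero,
      single_one_apply_one] <;> [rw [a0, a1, o0, o1]; rw [b0, b1, o0, o1]; rw [f0, f1, o0, o1]] <;>
    split_ifs <;> omega

end Literature.Probability.Percolation

end
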